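/-
Copyright: cell pub-balaban-gaps (YM BLITZ Y1, track G1), seat g1-p2 GEN 8 (unit `pub-balaban-gaps-g1-p2`).  Row (D4) NODE O,
JUNCTION J-3 (multi-level), COVARIANT: [B9] Cor. 3.5's step for the COVARIANT SHIFT `V_W = Δ_1 ⊗ 1 − Δ_W` of (3.50)–(3.54) (transport
defects `W_b = R(U′_b) − 1` with the two (3.37)-type windows) ON THE GENUINE MULTI-LEVEL FLAT PROPAGATOR `η²G′ ⊗ 1_F` of [4] Prop. 2.2
for a nested family of domains of the torus — the instance of the carrier-generic `D4WalkBlockShiftStep` at the fundamental box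
`boxDom N₀` with the periodic unit translations `tshift N₀ e_μ` and the letters of `D4WalkBlockFlatFibreMultiLevel`: constants uniform
in `k`, the torus, the family `{Ω_j}`, the fibre and `η⁻¹`.  HONEST FRAMING: the flat operator is the lineage's scalar model; the
defects are hypothesis SHAPES (Bałaban's `U′ = e^{iηA}` NOT constructed); (D4) NOT discharged (instance 0∕1); NOT BetaPertH, NOT
continuum, NOT Clay.
-/
import Summits.QuantumFields.BalabanUV.Gaps.D4WalkBlockFlatFibreMultiLevel
import Summits.QuantumFields.BalabanUV.Gaps.D4WalkBlockShiftStep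

/-!
# `Gaps.D4WalkBlockCovariantShiftMultiLevel` — Cor. 3.5's step for the covariant Laplacian in a transporter background on the
# genuine multi-level flat propagator of [4]'s nested family (cell pub-balaban-gaps, seat g1-p2 gen 8)

HONEST DEPENDENCY (cell pub-balaban, verbatim): continuum YM on T⁴ ⇐ BetaPertH ∧ nine spine estimates (0/9 proved);
BetaPertH ⇐ (D1) ∧ (D4) ∧ CAP+tail.

* §1 `tdist1_cubeML_tshift_le_one` — a periodic translation by a vector supported on one axis with entry `|t_μ| ≤ 1` moves the top
  cube by `d₁ ≤ 1` (only the `μ`-th cube coordinate moves, by circular size `≤ 1`: `circAbs_ediv_le_one`); `…_symm_unitVec_…`;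
* §2 `relab_tshift_eq`, **`Dfw_tshift_eq`** — on `boxDom N₀ × F` with `sh μ = tshift N₀ e_μ` and `η = L^{−k}`, the generic forward
  η-difference `Dfw` of `D4WalkBlockShiftAlgebra` IS `(L^k·∂_μ) ⊗ 1_F` (`∂_μ = dT μ = shiftMat e_μ − 1` of the lit-balaban lineage) —
  the derivative operator of `D4WalkBlockFlatMultiLevel`'s letters;
* §3 **`blockWalkExpansion_covShift_multiLevelTorus`** — ∃ `δ₁, C, M₀ > 0`, `N₀ ≥ 1` (functions of `d, ℓ`, weight windows ONLY): for
  every admissible `(k, M_h, R, P, D, a, c, Kc)` of [4] Prop. 2.2 on the torus, every finite fibre, every holomorphic family of transport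
  defects `W^±_μ(u,x) ∈ Matrix F F ℂ` with the BOND window `Σ_b‖W^±_μ(u,x)_{ab}‖ ≤ ηα` and the DIVERGENCE window
  `Σ_b‖(Σ_μW⁺_μ + W⁻_μ)(u,x)_{ab}‖ ≤ η²α′` (`η = L^{−k}`), every cube row sum `(μ, c_μ)`, `2μ ≤ ε`, `2μ ≤ δ₁ − ε − μ`, margin
  `c_μ(c_μ·1·(1·((α′ + Σ_ι α·covB δ₁ ι)C))c_μ)c_μ < 1`: with `W = η²(G′.map ofReal)`, `(W ⊗ 1)(1 − V_W(u)(W ⊗ 1))⁻¹` — the walk-expansion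
  content of `(Δ_W + Q-terms)⁻¹` for the nested family — is a block walk expansion at `(ε − 2μ, δ₁ − ε − 3μ, c_μC(1·(1−q)⁻¹)c_μ, δ₁ − 2μ)`
  with the relative derivative letters `covB δ₁`, dominating distances; and `V_W = Δ_1 ⊗ 1 − Δ_W` on this carrier
  (`D4WalkBlockShiftStep.flatLap_sub_covLap`).
WHAT IT IS NOT.  The windows FROM (3.37) for `U′ = e^{iηA}` (one-scale: 61a∕61b), the averaging corrections and the genuine covariant
averaging (one-scale: 62–64, 66) on this carrier; Bałaban's `V′(A)`; (D4) instance 0∕1; words of row (D4) UNCHANGED.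

References: T. Bałaban, Comm. Math. Phys. **99** (1985) 389–434 [B9], (3.50)–(3.54) pp. 400–401, (3.60)–(3.65) pp. 402–403, Cor. 3.5
p. 407, (3.37) p. 396; Comm. Math. Phys. **96** (1984) 223–250 [4], Prop. 2.2 (2.67) p. 234, p. 224; Comm. Math. Phys. **116** (1988) [II], (1.11) p. 5.
-/

noncomputable section

namespace Summit.QuantumFields.BalabanUV.Gaps.D4WalkBlockCovariantShiftMultiLevel

open Finset Metric
open scoped Matrix
open Literature.MathematicalPhysics.QuantumFieldTheory.Balaban1983to89
open Literature.MathematicalPhysics.QuantumFieldTheory.Balaban1983to89.B4Reflection242 (boxDom mem_boxDom blk)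
open Literature.MathematicalPhysics.QuantumFieldTheory.Balaban1983to89.B4TorusKernel.MultiPeriod (circAbs circAbs_nonneg
  circAbs_add_mul circAbs_le_abs translate translate_apply)
open Literature.MathematicalPhysics.QuantumFieldTheory.Balaban1983to89.B4Sect5Torus (ccoord ccoord_cast ccoord_self)
open Literature.MathematicalPhysics.QuantumFieldTheory.Balaban1983to89.B9SectDWalk (DomBy)
open Literature.MathematicalPhysics.QuantumFieldTheory.Balaban1983to89.B9Thm34Ext (toB6)
open Literature.MathematicalPhysics.QuantumFieldTheory.Balaban1983to89.B9Thm37GlueTorus (torusGeom tdist1 tdist1_nonneg)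
open Literature.MathematicalPhysics.QuantumFieldTheory.Balaban1983to89.TreeLengthTorus (TPt)
open Literature.MathematicalPhysics.QuantumFieldTheory.Balaban1983to89.B5TorusCover (UT)
open Literature.MathematicalPhysics.QuantumFieldTheory.Balaban1983to89.B11SectG (RowSum)
open Literature.MathematicalPhysics.QuantumFieldTheory.Balaban1983to89.B6MultiLevelBoxOperator (N0)
open Literature.MathematicalPhysics.QuantumFieldTheory.Balaban1983to89.B6MultiLevelTorusOperator (TDomains gmlT tshift twrap
  tshift_val tshift_val_eq_translate tshift_symm_apply shiftMat unitVec one_le_of_mem)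
open Literature.MathematicalPhysics.QuantumFieldTheory.Balaban1983to89.B6Ineq243TwoLevelBox (aNext)
open Literature.MathematicalPhysics.QuantumFieldTheory.Balaban1983to89.B6Prop22DerivMultiLevelTorus (dT)
open Summit.QuantumFields.BalabanUV.Gaps.D4WalkBlock (blockNorm BlockWalkExpansion)
open Summit.QuantumFields.BalabanUV.Gaps.D4WalkBlockMultiLevelGeometry (cubeML cubeML_val circAbs_ediv_le_one
  circAbs_le_of_abs_sub_mul_le)
open Summit.QuantumFields.BalabanUV.Gaps.D4WalkBlockFlatFibreMultiLevel (flatLettersFibre_multiLevelTorus)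
open Summit.QuantumFields.BalabanUV.Gaps.D4WalkBlockShiftAlgebra (relab relab_eq_blockDiagonal Sfw Dfw covDop covB covShift)
open Summit.QuantumFields.BalabanUV.Gaps.D4WalkBlockShiftStep (blockWalkExpansion_covShift_of_letters)

variable {d : ℕ}

/-! ## §1. A unit periodic translation moves the top cube by `d₁ ≤ 1` -/

section Shift

variable {ℓ Mh k : ℕ} {P : Fin (d + 1) → ℕ} {Kc : Fin (d + 1) → ℕ} [∀ i, NeZero (Kc i)]

/-- **A periodic translation along ONE axis by `|t_μ| ≤ 1` moves the top cube by `d₁ ≤ 1`**: the other cube coordinates do not move,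
the `μ`-th moves by circular size `≤ 1` (`circAbs_ediv_le_one`). -/
theorem tdist1_cubeML_tshift_le_one (hKc : ∀ i, N0 ℓ Mh k P i = (ℓ + 1) ^ k * Kc i) (x : ↥(boxDom (N0 ℓ Mh k P)))
    (μ : Fin (d + 1)) {t : Fin (d + 1) → ℤ} (ht0 : ∀ i, i ≠ μ → t i = 0) (ht1 : |t μ| ≤ 1) :
    tdist1 Kc (cubeML ℓ k Kc (tshift (N0 ℓ Mh k P) t x).1) (cubeML ℓ k Kc x.1) ≤ 1 := by
  have hK1 : ∀ i, 1 ≤ Kc i := fun i => Nat.one_le_iff_ne_zero.2 (NeZero.ne _)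
  have hx := x.2
  have hy := (tshift (N0 ℓ Mh k P) t x).2
  obtain ⟨m, hm⟩ := tshift_val_eq_translate (N0 ℓ Mh k P) t x
  -- coordinate `i ≠ μ` of the translate equals that of `x`
  have hsame : ∀ i, i ≠ μ → (tshift (N0 ℓ Mh k P) t x).1 i = x.1 i := by
    intro i hi
    rw [tshift_val]
    show (x.1 + t) i % (N0 ℓ Mh k P i : ℤ) = x.1 i
    rw [Pi.add_apply, ht0 i hi, add_zero]
    exact Int.emod_eq_of_lt ((mem_boxDom.1 hx) i).1 ((mem_boxDom.1 hx) i).2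
  have hcoord : ∀ i, (ccoord Kc (UT.toSite Kc (cubeML ℓ k Kc (tshift (N0 ℓ Mh k P) t x).1))
      (UT.toSite Kc (cubeML ℓ k Kc x.1)) i : ℝ) ≤ if i = μ then 1 else 0 := by
    intro i
    have hcast := ccoord_cast hK1 (UT.toSite Kc (cubeML ℓ k Kc (tshift (N0 ℓ Mh k P) t x).1))
      (UT.toSite Kc (cubeML ℓ k Kc x.1)) i
    rw [cubeML_val hKc hy, cubeML_val hKc hx] at hcast
    by_cases hi : i = μ
    · subst hi
      rw [if_pos rfl]
      -- the `μ`-th fine coordinate moved by `t_μ + N₀_μ·m_μ`, circular size ≤ 1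
      have hdiff : (tshift (N0 ℓ Mh k P) t x).1 i - x.1 i = t i + (N0 ℓ Mh k P i : ℤ) * m i := by
        rw [hm, translate_apply, Pi.add_apply]; ring
      have hc1 : circAbs (N0 ℓ Mh k P i) ((tshift (N0 ℓ Mh k P) t x).1 i - x.1 i) ≤ 1 := by
        rw [hdiff, circAbs_add_mul]
        exact (circAbs_le_abs (one_le_of_mem hx i) _).trans ht1
      rw [hKc i] at hc1
      have hstep := circAbs_ediv_le_one (Nat.one_le_pow _ _ (by omega)) (hK1 i) hc1
      have : (ccoord Kc (UT.toSite Kc (cubeML ℓ k Kc (tshift (N0 ℓ Mh k P) t x).1))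
          (UT.toSite Kc (cubeML ℓ k Kc x.1)) i : ℤ) ≤ 1 := by rw [hcast]; exact hstep
      exact_mod_cast this
    · rw [if_neg hi]
      have h0 : (ccoord Kc (UT.toSite Kc (cubeML ℓ k Kc (tshift (N0 ℓ Mh k P) t x).1))
          (UT.toSite Kc (cubeML ℓ k Kc x.1)) i : ℤ) = 0 := by
        rw [hcast, hsame i hi, sub_self]
        exact B4Sect5Torus.circAbs_zero _
      have : (ccoord Kc (UT.toSite Kc (cubeML ℓ k Kc (tshift (N0 ℓ Mh k P) t x).1))
          (UT.toSite Kc (cubeML ℓ k Kc x.1)) i : ℝ) = 0 := by exact_mod_cast h0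
      rw [this]
  unfold tdist1
  calc ∑ i, (ccoord Kc (UT.toSite Kc (cubeML ℓ k Kc (tshift (N0 ℓ Mh k P) t x).1)) (UT.toSite Kc (cubeML ℓ k Kc x.1)) i : ℝ)
      ≤ ∑ i : Fin (d + 1), (if i = μ then (1 : ℝ) else 0) := Finset.sum_le_sum fun i _ => hcoord i
    _ = 1 := by rw [Finset.sum_ite_eq']; simp

/-- The inverse unit translation `σ_{e_μ}⁻¹ = σ_{−e_μ}` moves the top cube by `d₁ ≤ 1`. -/
theorem tdist1_cubeML_tshift_symm_unitVec_le_one (hKc : ∀ i, N0 ℓ Mh k P i = (ℓ + 1) ^ k * Kc i) (μ : Fin (d + 1))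
    (x : ↥(boxDom (N0 ℓ Mh k P))) :
    tdist1 Kc (cubeML ℓ k Kc ((tshift (N0 ℓ Mh k P) (unitVec μ)).symm x).1) (cubeML ℓ k Kc x.1) ≤ 1 := by
  rw [tshift_symm_apply]
  refine tdist1_cubeML_tshift_le_one hKc x μ (fun i hi => ?_) ?_
  · simp [unitVec, hi]
  · simp [unitVec]

end Shift

/-! ## §2. The generic forward difference on `boxDom N₀ × F` is `(L^k·∂_μ) ⊗ 1_F` -/

section Ident

variable {N : Fin (d + 1) → ℕ} {F : Type} [Fintype F] [DecidableEq F]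

omit [Fintype F] in
/-- `relab (σ_v) = (shiftMat v).map ofReal ⊗ 1_F` (the lineage's permutation matrix of the torus translation). -/
theorem relab_tshift_eq (v : Fin (d + 1) → ℤ) :
    relab ↥(boxDom N) F (tshift N v) = Matrix.blockDiagonal fun _ : F => (shiftMat N v).map ((↑) : ℝ → ℂ) := by
  rw [relab_eq_blockDiagonal]
  congr 1
  funext a
  ext x y
  simp only [Matrix.of_apply, Matrix.map_apply, shiftMat]
  split_ifs <;> simp

omit [Fintype F] in
/-- **`Dfw = (L^k·∂_μ) ⊗ 1_F`** on `boxDom N₀ × F` with `sh μ = σ_{e_μ}` and `η = L^{−k}`: the generic forward η-difference of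
`D4WalkBlockShiftAlgebra` is the derivative operator of `D4WalkBlockFlatMultiLevel`'s letters (`∂_μ = dT μ = shiftMat e_μ − 1`).
[cite: Balaban1984PropagatorsII, (2.67) p.234 (second entry); Balaban1985BackgroundPropagators, (3.23) p.394] -/
theorem Dfw_tshift_eq (ℓ k : ℕ) (μ : Fin (d + 1)) :
    Dfw ↥(boxDom N) F (fun ν => tshift N (unitVec ν)) ((((ℓ : ℝ) + 1) ^ k)⁻¹) μ =
      Matrix.blockDiagonal fun _ : F => (((ℓ : ℂ) + 1) ^ k : ℂ) • (dT N μ).map ((↑) : ℝ → ℂ) := by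
  unfold Dfw Sfw
  rw [relab_tshift_eq]
  have hη : ((((((ℓ : ℝ) + 1) ^ k)⁻¹ : ℝ) : ℂ))⁻¹ = (((ℓ : ℂ) + 1) ^ k : ℂ) := by push_cast; rw [inv_inv]
  rw [hη]
  have hd : (dT N μ).map ((↑) : ℝ → ℂ) = (shiftMat N (unitVec μ)).map ((↑) : ℝ → ℂ) - 1 := by
    unfold dT
    rw [Matrix.map_sub _ (fun a b => Complex.ofReal_sub a b), Matrix.map_one _ Complex.ofReal_zero Complex.ofReal_one]
  rw [hd]
  have e : (fun _ : F => (((ℓ : ℂ) + 1) ^ k : ℂ) • ((shiftMat N (unitVec μ)).map ((↑) : ℝ → ℂ) - 1)) =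
      (((ℓ : ℂ) + 1) ^ k : ℂ) • ((fun _ : F => (shiftMat N (unitVec μ)).map ((↑) : ℝ → ℂ)) - 1) := by
    funext a; simp only [Pi.smul_apply, Pi.sub_apply, Pi.one_apply]
  rw [e, Matrix.blockDiagonal_smul, Matrix.blockDiagonal_sub, Matrix.blockDiagonal_one]

end Ident

/-! ## §3. Cor. 3.5's step for the covariant shift on the genuine multi-level flat propagator -/

section Step

variable {dd N' : ℕ} {E : Type*} [NormedAddCommGroup E] [NormedSpace ℂ E]

/-- **[B9] COR. 3.5's STEP FOR THE COVARIANT SHIFT ON THE GENUINE MULTI-LEVEL FLAT PROPAGATOR — UNIFORM IN `k`, THE TORUS, `{Ω_j}`,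
THE FIBRE AND `η⁻¹`.**  There are `δ₁, C, M₀ > 0`, `N₀ ≥ 1` (functions of `d, ℓ` and the weight windows only) such that for every
admissible `(k, M_h, R, P, D, a, c)` of [4] Prop. 2.2 on the torus, every cube torus `UT Kc` of the top blocks (`N₀ = L^k·Kc`), every
finite fibre `F`, every holomorphic family of transport defects `W^±_μ(u, x) ∈ Matrix F F ℂ` on a ball with the BOND window
`Σ_b‖W^±_μ(u,x)_{ab}‖ ≤ ηα` and the DIVERGENCE window `Σ_b‖(Σ_μ W⁺_μ + W⁻_μ)(u,x)_{ab}‖ ≤ η²α′` (`η = L^{−k}`, `α, α′ ≥ 0`), every cube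
row sum `(μ, c_μ)`, rates `0 ≤ μ`, `2μ ≤ ε`, `2μ ≤ δ₁ − ε − μ`, and the MARGIN `c_μ(c_μ·1·(1·((α′ + Σ_ι α·covB δ₁ ι)C))c_μ)c_μ < 1`: with
`W = η²(G′.map ofReal)` (`G′ = gmlT = Δ′_a^{−1}` of the nested family `D`) and `V_W` the covariant shift of `D4WalkBlockShiftAlgebra`
for the unit translations `σ_{e_μ}` of the fundamental box: `(W ⊗ 1)(1 − V_W(u)(W ⊗ 1))⁻¹` is a block walk expansion at
`(ε − 2μ, δ₁ − ε − 3μ, c_μC(1·(1−q)⁻¹)c_μ, δ₁ − 2μ)` with the relative derivative letters `covB δ₁` and dominating distances.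
[cite: Balaban1985BackgroundPropagators, Cor. 3.5 p.407, (3.50)–(3.54) pp.400–401, (3.60)–(3.64) p.402, (3.37) p.396; Balaban1984PropagatorsII, Prop. 2.2 (2.67) p.234, p.224; Balaban1988RG2Cluster, (1.11) p.5] -/
theorem blockWalkExpansion_covShift_multiLevelTorus (d ℓ : ℕ) (hℓ : 1 ≤ ℓ) (aminus aplus a2minus a2plus : ℝ) (ha : 0 < aminus)
    (ha2 : 0 < a2minus) :
    ∃ δ₁ C M₀ : ℝ, ∃ N₀ : ℕ, 0 < δ₁ ∧ 0 < C ∧ 0 < M₀ ∧ 0 < N₀ ∧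
      ∀ (k Mh R : ℕ), 3 ≤ Mh → M₀ ≤ ((ℓ : ℝ) + 1) * Mh → 2 * (ℓ + 1) ≤ R → N₀ + 1 ≤ R * ((ℓ + 1) * Mh) →
      ∀ (P : Fin (d + 1) → ℕ) (hP : ∀ μ, 1 ≤ P μ) (hP4 : ∀ μ, 4 ≤ P μ) (D : TDomains d ℓ Mh k P R) (a c : ℕ → ℝ),
        (∀ i, 1 ≤ i → aminus ≤ a i ∧ a i ≤ aplus) → (∀ i, 1 ≤ i → a2minus ≤ c i ∧ c i ≤ a2plus) →
        (∀ i, 1 ≤ i → a (i + 1) = aNext ℓ (a i) (c i)) →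
      ∀ (Kc : Fin (d + 1) → ℕ) [∀ i, NeZero (Kc i)], (∀ i, N0 ℓ Mh k P i = (ℓ + 1) ^ k * Kc i) →
      ∀ (F : Type) [Fintype F] [DecidableEq F] (c₀ : B13.Consts) (Xs : Finset (UT Kc)) (Rb : ℝ)
        (Wp Wm : Fin (d + 1) → E → ↥(boxDom (N0 ℓ Mh k P)) → Matrix F F ℂ) (α α' ε μ cμ : ℝ),
      (∀ ν x a' b, DifferentiableOn ℂ (fun u => Wp ν u x a' b) (ball (0 : E) Rb)) →
      (∀ ν x a' b, DifferentiableOn ℂ (fun u => Wm ν u x a' b) (ball (0 : E) Rb)) →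
      0 ≤ α → 0 ≤ α' →
      (∀ ν, ∀ u ∈ ball (0 : E) Rb, ∀ x a', ∑ b, ‖Wp ν u x a' b‖ ≤ (((ℓ : ℝ) + 1) ^ k)⁻¹ * α) →
      (∀ ν, ∀ u ∈ ball (0 : E) Rb, ∀ x a', ∑ b, ‖Wm ν u x a' b‖ ≤ (((ℓ : ℝ) + 1) ^ k)⁻¹ * α) →
      (∀ u ∈ ball (0 : E) Rb, ∀ x a', ∑ b, ‖(∑ ν, (Wp ν u x + Wm ν u x)) a' b‖ ≤ ((((ℓ : ℝ) + 1) ^ k)⁻¹) ^ 2 * α') →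
      0 ≤ μ → 2 * μ ≤ ε → 2 * μ ≤ δ₁ - ε - μ → 0 ≤ cμ →
      RowSum (toB6 (torusGeom Kc 0 0 0) 0 True) μ cμ →
      cμ * (cμ * 1 * (1 * ((α' + ∑ j : Fin (d + 1) ⊕ Fin (d + 1), α * covB δ₁ j) * C)) * cμ) * cμ < 1 →
      ∃ (W : Type) (T : W → (TPt dd N' → ℂ) → E → Matrix (↥(boxDom (N0 ℓ Mh k P)) × F) (↥(boxDom (N0 ℓ Mh k P)) × F) ℂ)
        (SX' : Set W) (A' : W → ℝ) (D' : W → UT Kc → UT Kc → ℝ),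
        BlockWalkExpansion c₀ (fun q : ↥(boxDom (N0 ℓ Mh k P)) × F => cubeML ℓ k Kc q.1.1)
          (fun q : ↥(boxDom (N0 ℓ Mh k P)) × F => cubeML ℓ k Kc q.1.1)
          (fun (_ : TPt dd N' → ℂ) u =>
            Matrix.blockDiagonal (fun _ : F =>
                ((((ℓ : ℂ) + 1) ^ (2 * k))⁻¹ : ℂ) • (gmlT (N0 ℓ Mh k P) ℓ k D.lev a).map ((↑) : ℝ → ℂ)) *
              (1 - covShift ↥(boxDom (N0 ℓ Mh k P)) F (fun ν => tshift (N0 ℓ Mh k P) (unitVec ν))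
                  ((((ℓ : ℝ) + 1) ^ k)⁻¹) Wp Wm u *
                Matrix.blockDiagonal (fun _ : F =>
                  ((((ℓ : ℂ) + 1) ^ (2 * k))⁻¹ : ℂ) • (gmlT (N0 ℓ Mh k P) ℓ k D.lev a).map ((↑) : ℝ → ℂ)))⁻¹)
          Xs Rb (ε - 2 * μ) (δ₁ - ε - μ - 2 * μ)
          (cμ * C * (1 * (1 - cμ * (cμ * 1 * (1 * ((α' + ∑ j : Fin (d + 1) ⊕ Fin (d + 1), α * covB δ₁ j) * C)) * cμ) *
            cμ)⁻¹) * cμ)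
          T SX' A' D' (δ₁ - 2 * μ) ∧
        (∀ (j : Fin (d + 1) ⊕ Fin (d + 1)) ω (σ : TPt dd N' → ℂ), (∀ i, ‖σ i‖ ≤ Real.exp c₀.κ₁) → ∀ u ∈ ball (0 : E) Rb,
          ∀ Y Y',
          blockNorm (fun q : ↥(boxDom (N0 ℓ Mh k P)) × F => cubeML ℓ k Kc q.1.1)
              (fun q : ↥(boxDom (N0 ℓ Mh k P)) × F => cubeML ℓ k Kc q.1.1)
              (covDop ↥(boxDom (N0 ℓ Mh k P)) F (fun ν => tshift (N0 ℓ Mh k P) (unitVec ν)) ((((ℓ : ℝ) + 1) ^ k)⁻¹) j *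
                T ω σ u) Y Y' ≤
            covB (ι := Fin (d + 1)) δ₁ j * (A' ω * Real.exp (-((δ₁ - 2 * μ) * D' ω Y Y')))) ∧
        ∀ ω, DomBy (toB6 (torusGeom Kc 0 0 0) 0 True) (D' ω) := by
  obtain ⟨δ₁, C, M₀, N₀, hδ₁, hC, hM₀, hN₀, hflat⟩ := flatLettersFibre_multiLevelTorus d ℓ hℓ aminus aplus a2minus a2plus ha ha2
  refine ⟨δ₁, C, M₀, N₀, hδ₁, hC, hM₀, hN₀, ?_⟩
  intro k Mh R hMh hM hR hRM P hP hP4 D a c haw hcw hac Kc _ hKc F _ _ c₀ Xs Rb Wp Wm α α' ε μ cμ hWph hWmh hα hα' hWp hWm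
    hdiv hμ hμε hμκ hcμ hrow hq
  have hl := hflat k Mh R hMh hM hR hRM P hP hP4 D a c haw hcw hac Kc hKc F
  have hη : (0 : ℝ) < (((ℓ : ℝ) + 1) ^ k)⁻¹ := by positivity
  refine blockWalkExpansion_covShift_of_letters (sh := fun ν => tshift (N0 ℓ Mh k P) (unitVec ν))
    (fun x : ↥(boxDom (N0 ℓ Mh k P)) => cubeML ℓ k Kc x.1) hη
    (fun ν x => tdist1_cubeML_tshift_symm_unitVec_le_one hKc ν x) _ hC.le hδ₁.le (fun Y Y' => (hl Y Y').1)
    (fun ν Y Y' => ?_) c₀ Xs Rb Wp Wm α α' ε μ cμ hWph hWmh hα hα' hWp hWm hdiv hμ hμε hμκ hcμ hrow hq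
  rw [Dfw_tshift_eq]
  exact (hl Y Y').2 ν

end Step

end Summit.QuantumFields.BalabanUV.Gaps.D4WalkBlockCovariantShiftMultiLevel

end
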